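import Summits.KontsevichZagierPeriods.KontsevichZagierPeriods.Theorems.RootDecompRationalCubeDichotomyRankDescentP20

/-! # `RootDecompRationalCubeDichotomyRankDescentP21` — part 7/9 of the mechanical ≤400-line split of `RankDescent_delta_v12_to_v14h_P15plus.lean` (sha256 311877f354eea7b0…)
Source: decomp-kz lens-2 g15 RankDescent_delta_v12_to_v14h_P15plus.lean @311877f3 (critic CLEARED g7-6 l.1400: 26322 ⟺ LetterDegenerateKernel, GenericKernel THEOREM); --supports stmt-KontsevichZagierPeriods-26322.
Split by census-1 g10 `gen/splitlean.py`: scopes re-opened with their `open`/`variable`/`set_option` context; mathematics and declaration order unchanged. -/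

noncomputable section
open MeasureTheory Set MvPolynomial
open Literature.NumberTheory.Transcendental
open Literature.NumberTheory.Transcendental.KZ
namespace Summit.KontsevichZagierPeriods.RootDecompRationalCubeDichotomy.Rung26322.RankDescent
variable {M : ℕ}
open MeasureTheory Set MvPolynomial in
open Literature.NumberTheory.Transcendental in
open Literature.NumberTheory.Transcendental.KZ in
open MeasureTheory Set MvPolynomial in
open Literature.NumberTheory.Transcendental in
open Literature.NumberTheory.Transcendental.KZ in
/-- Soundness: congruent formal combinations have equal values. (cite KontsevichZagier2001, §1.2) -/
private theorem eval_eq_of_sub_mem {x y : FormalRep} (h : x - y ∈ relations) : eval x = eval y := by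
  have h' := relations_le_ker_eval_holds h
  rw [AddMonoidHom.mem_ker, map_sub] at h'
  exact sub_eq_zero.1 h'

section LetterCriterion
variable {k : ℕ}
section SpecialResident

/-- **INJECTIVITY AT A GENERIC LEVEL.** In a zero-free, face-closed system that is letter-generic at level
`k+2`, every representation of dimension `k+2` with VALUE `0` has a FORMALLY EXACT numerator (simple poles):
`num ∈ Ex0m den`. (SPAN splits the numerator; the exact part has value in the lower span by face descent;
INDEP kills the letter coefficients.) (cite KontsevichZagier2001, §1.2) -/
theorem num_mem_ex0m_of_genAt {k : ℕ} (D : (k : ℕ) → Set (MvPolynomial (Fin k) ℚ)) (hz : ZeroFree D)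
    (hfc : FaceClosed D) (hG : GenAt D (k + 1)) (T : RFun (k + 1 + 1)) (hT : T.den ∈ D (k + 1 + 1))
    (h0 : T.rep.value = 0) : T.num ∈ Ex0m T.den := by
  classical
  obtain ⟨L, den, num, hden, hspan, hindep⟩ := hG
  obtain ⟨c, hc⟩ := hspan T.den hT T.num
  set ℓR : L → RFun (k + 1 + 1) := fun i => ⟨num i, den i, hz _ _ (hden i)⟩ with hℓR
  set E : RFun (k + 1 + 1) := ⟨T.num - c.sum (fun i r => C r * num i), T.den, T.den_ne⟩ with hE
  have hEmem : E.num ∈ Ex0m E.den := hc.2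
  obtain ⟨G, hG⟩ := mem_ex0m_iff.mp hEmem
  set S : Finset L := c.support with hS
  -- (1) the formal split
  have h1 : KZ.of T.rep - KZ.of E.rep - ∑ i ∈ S, KZ.of (smulNum (c i) (ℓR i)).rep ∈ KZ.relations := by
    set U : RFun (k + 1 + 1) := ⟨c.sum (fun i r => C r * num i), T.den, T.den_ne⟩ with hU
    have hA : KZ.of T.rep - KZ.of (E.add U).rep ∈ KZ.relations :=
      RFun.rel_of_eqOn fun x hx => by
        rw [RFun.fn_add hx, RFun.fn_apply, RFun.fn_apply, RFun.fn_apply]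
        show aeval x T.num / aeval x T.den
          = aeval x (T.num - c.sum (fun i r => C r * num i)) / aeval x T.den
            + aeval x (c.sum (fun i r => C r * num i)) / aeval x T.den
        rw [map_sub, sub_div, sub_add_cancel]
    have hB := RFun.rel_add E U
    have hC : KZ.of U.rep - ∑ i ∈ S, KZ.of (smulNum (c i) (ℓR i)).rep ∈ KZ.relations :=
      RFun.rel_sum S (fun i => smulNum (c i) (ℓR i)) U fun x _ => by
        rw [RFun.fn_apply]
        show aeval x (c.sum (fun i r => C r * num i)) / aeval x T.den = ∑ i ∈ S, (smulNum (c i) (ℓR i)).fn x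
        rw [Finsupp.sum, map_sum, Finset.sum_div]
        refine Finset.sum_congr rfl fun i hi => ?_
        rw [fn_smulNum, RFun.fn_apply]
        show aeval x (C (c i) * num i) / aeval x T.den = ((c i : ℚ) : ℝ) * (aeval x (num i) / aeval x (den i))
        rw [map_mul, MvPolynomial.aeval_C, eq_ratCast, hc.1 i hi, mul_div_assoc]
    have heq : KZ.of T.rep - KZ.of E.rep - ∑ i ∈ S, KZ.of (smulNum (c i) (ℓR i)).rep
        = (KZ.of T.rep - KZ.of (E.add U).rep) + (KZ.of (E.add U).rep - KZ.of E.rep - KZ.of U.rep)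
          + (KZ.of U.rep - ∑ i ∈ S, KZ.of (smulNum (c i) (ℓR i)).rep) := by abel
    rw [heq]
    exact add_mem (add_mem hA hB) hC
  -- (2) values
  have h2 : T.rep.value = E.rep.value + ∑ i ∈ S, ((c i : ℚ) : ℝ) * (ℓR i).rep.value := by
    have h1' : KZ.of T.rep - (KZ.of E.rep + ∑ i ∈ S, KZ.of (smulNum (c i) (ℓR i)).rep) ∈ KZ.relations := by
      rwa [sub_sub] at h1
    have := eval_eq_of_sub_mem h1'
    rw [eval_of, map_add, map_sum, eval_of] at this
    rw [this]
    congr 1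
    exact Finset.sum_congr rfl fun i _ => by rw [eval_of, value_smulNum]
  -- (3) the exact part has value in the lower span
  have h3 : KZ.of E.rep - ∑ p, KZ.of (faceFam E G p).rep ∈ KZ.relations := exact_rel_faceFam E G hG
  have h3v : E.rep.value ∈ VSpan D (k + 1) := by
    rw [value_eq_sum_of_rel _ _ _ h3]
    refine sum_mem fun p _ => value_mem_VSpan le_rfl _ ?_
    obtain ⟨c', hc', hd⟩ := faceFam_den E G p
    rw [hd]
    exact hfc _ _ hT _ _ hc'
  -- (4) INDEP
  have hCsum : c.sum (fun i r => (r : ℝ) * cubeVal (k + 1 + 1) (num i) (den i))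
      = ∑ i ∈ S, ((c i : ℚ) : ℝ) * (ℓR i).rep.value := by
    rw [Finsupp.sum]
    exact Finset.sum_congr rfl fun i _ => rfl
  have hmem : c.sum (fun i r => (r : ℝ) * cubeVal (k + 1 + 1) (num i) (den i)) ∈ VSpan D (k + 1) := by
    rw [hCsum, show ∑ i ∈ S, ((c i : ℚ) : ℝ) * (ℓR i).rep.value = -E.rep.value by linarith]
    exact neg_mem h3v
  have hc0 : c = 0 := hindep c hmem
  have := hc.2
  rwa [hc0, Finsupp.sum_zero_index, sub_zero] at this

/-! #### Landen's relation among the level-`j` letters `L_j(q) + L_j(−q) = 2^{1−j}·L_j(−q²)` -/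

/-- **Landen / duplication**: `L_j(q) + L_j(−q) = (2/2^j)·L_j(−q²)` for rational `q > 1`, every `j`
(`Li_j(z) + Li_j(−z) = 2^{1−j} Li_j(z²)` at `z = −1/q`, from the series `letter_hasSum`). [folklore] -/
theorem letter_landen (q : ℚ) (hq1 : 1 < q) (h₁ : 0 < q ∨ q < -1) (h₂ : 0 < -q ∨ -q < -1)
    (h₃ : 0 < -q ^ 2 ∨ -q ^ 2 < -1) (j : ℕ) :
    letter q h₁ j + letter (-q) h₂ j = 2 / 2 ^ j * letter (-q ^ 2) h₃ j := by
  have hq0 : (0 : ℝ) < q := by exact_mod_cast (zero_lt_one.trans hq1)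
  have hx0 : (q : ℝ) ≠ 0 := hq0.ne'
  have ha₁ : 1 < |q| := by rwa [abs_of_pos (zero_lt_one.trans hq1)]
  have ha₂ : 1 < |(-q)| := by rwa [abs_neg, abs_of_pos (zero_lt_one.trans hq1)]
  have ha₃ : 1 < |(-q ^ 2)| := by
    rw [abs_neg, abs_of_pos (by positivity)]; nlinarith
  have s₁ := letter_hasSum q h₁ ha₁ j
  have s₂ := letter_hasSum (-q) h₂ ha₂ j
  have s₃ := letter_hasSum (-q ^ 2) h₃ ha₃ j
  set F : ℕ → ℝ := fun k => (-1 : ℝ) ^ k / ((q : ℝ) ^ (k + 1) * ((k : ℝ) + 1) ^ j)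
    + (-1 : ℝ) ^ k / ((((-q : ℚ) : ℝ)) ^ (k + 1) * ((k : ℝ) + 1) ^ j) with hF
  have hsum : HasSum F (letter q h₁ j + letter (-q) h₂ j) := s₁.add s₂
  have heven : HasSum (fun i : ℕ => F (2 * i)) 0 := by
    have : (fun i : ℕ => F (2 * i)) = fun _ => 0 := by
      funext i
      simp only [hF, Rat.cast_neg]
      rw [Odd.neg_pow (⟨i, rfl⟩ : Odd (2 * i + 1)), neg_mul, div_neg, add_neg_cancel]
    rw [this]
    exact hasSum_zero
  have hodd : HasSum (fun i : ℕ => F (2 * i + 1)) (2 / 2 ^ j * letter (-q ^ 2) h₃ j) := by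
    have key := s₃.mul_left (2 / 2 ^ j : ℝ)
    refine key.congr_fun fun i => ?_
    simp only [hF, Rat.cast_neg, Rat.cast_pow]
    have e1 : ((-(q : ℝ)) ^ (2 * i + 1 + 1)) = (q : ℝ) ^ (2 * i + 1 + 1) :=
      Even.neg_pow ⟨i + 1, by ring⟩ _
    have e2 : (-1 : ℝ) ^ (2 * i + 1) = -1 := Odd.neg_one_pow ⟨i, rfl⟩
    have e3 : (-(q : ℝ) ^ 2) ^ (i + 1) = (-1) ^ (i + 1) * (q : ℝ) ^ (2 * i + 1 + 1) := by
      rw [neg_pow, ← pow_mul]; ring_nf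
    have e4 : (((2 * i + 1 : ℕ) : ℝ) + 1) ^ j = (2 : ℝ) ^ j * (((i : ℕ) : ℝ) + 1) ^ j := by
      rw [← mul_pow]; push_cast; ring
    have h1i : ((-1 : ℝ) ^ i) ≠ 0 := pow_ne_zero _ (by norm_num)
    rw [e1, e2, e3, e4, pow_succ (-1 : ℝ) i]
    field_simp
    ring
  have hsum' := heven.even_add_odd hodd
  rw [zero_add] at hsum'
  exact hsum.unique hsum'

/-! #### The Landen triple `Q_L = (q + xy)(−q + xy)(−q² + xy)` -/

section LandenResident

variable (q : ℚ) (hq1 : 1 < q)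
include hq1

/-- Auxiliary step `landen_h₁`: landen h₁. [bookkeeping] -/
theorem landen_h₁ : 0 < q ∨ q < -1 := Or.inl (zero_lt_one.trans hq1)
/-- Auxiliary step `landen_h₂`: landen h₂. [bookkeeping] -/
theorem landen_h₂ : 0 < -q ∨ -q < -1 := Or.inr (by linarith)
/-- Auxiliary step `landen_h₃`: landen h₃. [bookkeeping] -/
theorem landen_h₃ : 0 < -q ^ 2 ∨ -q ^ 2 < -1 := Or.inr (by nlinarith)

omit hq1 in
/-- `q₀ + xy = (u + q₀)(xy)`. [folklore] -/
theorem fhQ_two_eq_uOf (q₀ : ℚ) : fhQ 2 q₀ = uOf (Polynomial.X + Polynomial.C q₀) := by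
  rw [uOf_X_add_C, fhQ_eq, Fin.prod_univ_two, add_comm]

omit hq1 in
/-- The Landen denominator `Q_L = (q + xy)(−q + xy)(−q² + xy)`. (folklore) -/
def landenQ : MvPolynomial (Fin 2) ℚ := fhQ 2 q * (fhQ 2 (-q) * fhQ 2 (-q ^ 2))

omit hq1 in
/-- The Landen numerator `P_L = N₁ + N₂ − ½N₃` (`N_r = ∏_{s ≠ r} F_s`): `P_L/Q_L = 1/F₁ + 1/F₂ − ½·1/F₃`. (folklore) -/
def landenP : MvPolynomial (Fin 2) ℚ :=
  fhQ 2 (-q) * fhQ 2 (-q ^ 2) + fhQ 2 q * fhQ 2 (-q ^ 2) - C (1 / 2) * (fhQ 2 q * fhQ 2 (-q))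

omit hq1 in
/-- Auxiliary step `landenQ_eq_uOf`: landen Q eq u Of. [bookkeeping] -/
theorem landenQ_eq_uOf : landenQ q = uOf ((Polynomial.X + Polynomial.C q)
    * ((Polynomial.X + Polynomial.C (-q)) * (Polynomial.X + Polynomial.C (-q ^ 2)))) := by
  simp only [landenQ, fhQ_two_eq_uOf, map_mul]

omit hq1 in
/-- Auxiliary step `landenP_eq_uOf`: landen P eq u Of. [bookkeeping] -/
theorem landenP_eq_uOf : landenP q = uOf ((Polynomial.X + Polynomial.C (-q)) * (Polynomial.X + Polynomial.C (-q ^ 2))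
    + (Polynomial.X + Polynomial.C q) * (Polynomial.X + Polynomial.C (-q ^ 2))
    - Polynomial.C (1 / 2) * ((Polynomial.X + Polynomial.C q) * (Polynomial.X + Polynomial.C (-q)))) := by
  simp only [landenP, fhQ_two_eq_uOf, map_mul, map_add, map_sub, Polynomial.aeval_C, uOf, algebraMap_eq]

/-- Auxiliary step `landenQ_ne_zero`: landen Q ne zero. [bookkeeping] -/
theorem landenQ_ne_zero (x : Fin 2 → ℝ) (hx : x ∈ KZ.cube 2) : aeval x (landenQ q) ≠ 0 := by
  rw [landenQ, map_mul, map_mul]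
  exact mul_ne_zero (fhQ_ne_zero_of q (landen_h₁ q hq1) x hx)
    (mul_ne_zero (fhQ_ne_zero_of (-q) (landen_h₂ q hq1) x hx) (fhQ_ne_zero_of (-q ^ 2) (landen_h₃ q hq1) x hx))

/-- The Landen representation `[ [0,1]², P_L/Q_L ]`. (folklore) -/
def landenR : RFun 2 := ⟨landenP q, landenQ q, landenQ_ne_zero q hq1⟩

/-- **`P_L` is NOT simple-pole exact over `Q_L`** (residue obstruction along `{xy = −q}`:
`dproj(P_L)(−q) = N̂₁(−q) = (−2q)(−q−q²) ≠ 0`). [folklore] -/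
theorem landenP_not_mem_ex0m : landenP q ∉ Ex0m (landenQ q) := by
  intro h
  rw [landenQ_eq_uOf] at h
  have hR : ((Polynomial.X + Polynomial.C (-q)) * (Polynomial.X + Polynomial.C (-q ^ 2))).eval (-q) ≠ 0 := by
    simp only [Polynomial.eval_mul, Polynomial.eval_add, Polynomial.eval_X, Polynomial.eval_C]
    have : 0 < q := zero_lt_one.trans hq1
    exact mul_ne_zero (by linarith) (by nlinarith)
  have h0 := eval_dproj_eq_zero_of_mem_ex0m q rfl hR h
  rw [landenP_eq_uOf, dproj_uOf] at h0
  simp only [Polynomial.eval_mul, Polynomial.eval_add, Polynomial.eval_sub, Polynomial.eval_X,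
    Polynomial.eval_C] at h0
  have : 0 < q := zero_lt_one.trans hq1
  nlinarith

/-- **The Landen representation has value `0`**: `∫∫ P_L/Q_L = L_2(q) + L_2(−q) − ½L_2(−q²) = 0`.
[folklore] -/
theorem landenR_value : (landenR q hq1).rep.value = 0 := by
  set t : Fin 3 → RFun 2 := ![fhR q (landen_h₁ q hq1) 2 1, fhR (-q) (landen_h₂ q hq1) 2 1,
    smulNum (-(1 / 2)) (fhR (-q ^ 2) (landen_h₃ q hq1) 2 1)] with ht
  have hrel : KZ.of (landenR q hq1).rep - ∑ r, KZ.of (t r).rep ∈ KZ.relations := by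
    refine RFun.rel_sum Finset.univ t (landenR q hq1) fun x hx => ?_
    have n₁ := fhQ_ne_zero_of q (landen_h₁ q hq1) x hx
    have n₂ := fhQ_ne_zero_of (-q) (landen_h₂ q hq1) x hx
    have n₃ := fhQ_ne_zero_of (-q ^ 2) (landen_h₃ q hq1) x hx
    rw [Fin.sum_univ_three]
    simp only [ht, Matrix.cons_val_zero, Matrix.cons_val_one, Matrix.cons_val_two, Matrix.tail_cons,
      Matrix.head_cons, RFun.fn_apply, landenR, landenP, landenQ, smulNum_num, smulNum_den, fhR_num, fhR_den,
      map_mul, map_add, map_sub, MvPolynomial.aeval_C, map_one, eq_ratCast]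
    field_simp
    push_cast
    ring
  rw [value_eq_sum_of_rel _ _ _ hrel, Fin.sum_univ_three]
  simp only [ht, Matrix.cons_val_zero, Matrix.cons_val_one, Matrix.cons_val_two, Matrix.tail_cons,
    Matrix.head_cons, value_smulNum]
  have hL := letter_landen q hq1 (landen_h₁ q hq1) (landen_h₂ q hq1) (landen_h₃ q hq1) 2
  unfold letter fhV at hL
  push_cast
  linear_combination hL

/-- **A CERTIFIED SPECIAL RESIDENT: `Q_L = (q + xy)(−q + xy)(−q² + xy)` (`q > 1` rational) is NOT
letter-generic.** Any zero-free face-closed letter-generic system through `Q_L` would make the value-`0`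
numerator `P_L` simple-pole exact (`num_mem_ex0m_of_genAt`), contradicting the residue obstruction.
So the special piece of the node is NOT vacuous, and `[P_L/Q_L]` (value `0`, zero-free denominator: an
instance of 26322) lies outside the reach of THEOREM U — its decision needs a rule-(2) substitution
`(x,y) ↦ (x²,y²)` (Landen). (cite KontsevichZagier2001, §1.2) -/
theorem not_isGeneric_landenQ : ¬ IsGeneric (landenQ q) := by
  rintro ⟨D, hz, hfc, hQD, hgen⟩
  have hG : GenAt D (0 + 1) := hgen 0 le_rfl
  have hex := num_mem_ex0m_of_genAt D hz hfc hG (landenR q hq1) hQD (landenR_value q hq1)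
  exact landenP_not_mem_ex0m q hq1 hex

/-- The resident packaged: a zero-free denominator on the square with a value-`0` representation that is
special (not letter-generic) — an explicit member of `SpecialKernel`'s instance set. (cite KontsevichZagier2001, §1.2) -/
theorem special_resident :
    ¬ IsGeneric (landenQ q) ∧ (∀ x ∈ KZ.cube 2, aeval x (landenQ q) ≠ 0) ∧ (landenR q hq1).rep.value = 0
      ∧ (landenR q hq1).num ∉ Ex0m (landenR q hq1).den :=
  ⟨not_isGeneric_landenQ q hq1, landenQ_ne_zero q hq1, landenR_value q hq1, landenP_not_mem_ex0m q hq1⟩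

end LandenResident

end SpecialResident

section SubstitutionMove

/-! ### §18c — rule (2) along the coordinatewise power map on the CLOSED cube; the Landen resident DECIDED -/

/-- `Φₘ '' [0,1]ⁿ = [0,1]ⁿ` for the coordinatewise power map `Φₘ x = (xᵢᵐ)ᵢ`, `m ≠ 0` (`m`-th roots).
[folklore] -/
theorem image_coordPow_cube {n m : ℕ} (hm : m ≠ 0) :
    (fun x : Fin n → ℝ => BoxIntegral.coordPow m x) '' KZ.cube n = KZ.cube n := by
  refine Set.Subset.antisymm ?_ ?_
  · rintro _ ⟨x, hx, rfl⟩
    rw [KZ.mem_cube] at hx ⊢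
    exact fun i => ⟨pow_nonneg (hx i).1 m, pow_le_one₀ (hx i).1 (hx i).2⟩
  · intro y hy
    rw [KZ.mem_cube] at hy
    refine ⟨fun i => y i ^ ((m : ℝ)⁻¹), ?_, ?_⟩
    · rw [KZ.mem_cube]
      exact fun i => ⟨Real.rpow_nonneg (hy i).1 _, Real.rpow_le_one (hy i).1 (hy i).2 (by positivity)⟩
    · funext i
      simp only [BoxIntegral.coordPow_apply]
      exact Real.rpow_inv_natCast_pow (hy i).1 hm

/-- **Rule (2) along `x ↦ (xᵢᵐ)ᵢ` on the CLOSED unit cube** (`m ≥ 1`): `[r] − [r'] ∈ changeOfVariablesRel`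
when both domains are `[0,1]ⁿ` and `r.integrand x = r'.integrand (xᵢᵐ)ᵢ · mⁿ ∏ xᵢ^{m−1}` on the cube. Witness
`Φ = coordPow m`, `Φ' = coordPowDeriv m` (tree file `BoxCoordinatePowerMap`: polynomial hence `ℚ`-semialgebraic,
injective on the nonnegative orthant, `det Φ' = mⁿ ∏ xᵢ^{m−1} ≥ 0` on the cube) and `Φ '' [0,1]ⁿ = [0,1]ⁿ`.
(The tree's `DilationMove_of` is the open-box version; the rational-cube calculus lives on the closed cube.)
(cite KontsevichZagier2001, §1.2 rule (2)) -/
theorem coordPow_sub_mem_changeOfVariablesRel {n m : ℕ} (hm : m ≠ 0) (r r' : IntegralRep n)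
    (hr : r.domain = KZ.cube n) (hr' : r'.domain = KZ.cube n)
    (hint : ∀ x ∈ KZ.cube n, r.integrand x =
      r'.integrand (BoxIntegral.coordPow m x) * ((m : ℝ) ^ n * ∏ i, x i ^ (m - 1))) :
    of r - of r' ∈ changeOfVariablesRel := by
  refine ⟨n, r, r', fun x => BoxIntegral.coordPow m x, fun x => BoxIntegral.coordPowDeriv m x, ?_,
    fun x _ => BoxIntegral.hasFDerivWithinAt_coordPow m _ x, ?_, ?_, fun x hx => ?_, rfl⟩
  · refine (isSemialgebraicMapOn_aeval r.isSemialgebraic_domain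
      (fun j => (X j : MvPolynomial (Fin n) ℚ) ^ m)).congr fun x _ => ?_
    funext j
    simp [BoxIntegral.coordPow]
  · rw [hr]
    exact (BoxIntegral.injOn_coordPow hm).mono fun x hx i => ((KZ.mem_cube.1 hx) i).1
  · rw [hr', hr, image_coordPow_cube hm]
  · rw [hr] at hx
    rw [hint x hx, BoxIntegral.det_coordPowDeriv, abs_of_nonneg]
    exact mul_nonneg (pow_nonneg (Nat.cast_nonneg _) _)
      (Finset.prod_nonneg fun i _ => pow_nonneg ((KZ.mem_cube.1 hx) i).1 _)

/-- The substitution move for regular rational functions on the cube: `[T] ≡ [S]` when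
`T(x) = S((xᵢᵐ)ᵢ) · mⁿ ∏ xᵢ^{m−1}` on `[0,1]ⁿ` (`m ≥ 1`). (cite KontsevichZagier2001, §1.2 rule (2)) -/
theorem rel_coordPow {n m : ℕ} (hm : m ≠ 0) (T S : RFun n)
    (h : ∀ x ∈ KZ.cube n, T.fn x = S.fn (BoxIntegral.coordPow m x) * ((m : ℝ) ^ n * ∏ i, x i ^ (m - 1))) :
    KZ.of T.rep - KZ.of S.rep ∈ KZ.relations :=
  changeOfVariablesRel_subset_relations
    (coordPow_sub_mem_changeOfVariablesRel hm T.rep S.rep T.rep_domain S.rep_domain h)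

/-- Auxiliary step `coordPow_mem_cube` (§18c): coord Pow mem cube. [bookkeeping] -/
theorem coordPow_mem_cube {n : ℕ} (m : ℕ) {x : Fin n → ℝ} (hx : x ∈ KZ.cube n) :
    BoxIntegral.coordPow m x ∈ KZ.cube n := by
  rw [KZ.mem_cube] at hx ⊢
  exact fun i => ⟨pow_nonneg (hx i).1 m, pow_le_one₀ (hx i).1 (hx i).2⟩

section LandenDecided

variable (q : ℚ) (hq1 : 1 < q)

/-- `T_A(s) = [ [0,1]², 2s·xy / ((q + xy)(−q + xy)) ]`. (folklore) -/
def landenA (s : ℚ) : RFun 2 :=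
  ⟨C (2 * s) * (X 0 * X 1), fhQ 2 q * fhQ 2 (-q), fun x hx => by
    rw [map_mul]
    exact mul_ne_zero (fhQ_ne_zero_of q (landen_h₁ q hq1) x hx) (fhQ_ne_zero_of (-q) (landen_h₂ q hq1) x hx)⟩

/-- `T_B(s) = [ [0,1]², (s/2) / (−q² + xy) ]`. (folklore) -/
def landenB (s : ℚ) : RFun 2 :=
  ⟨C (s / 2), fhQ 2 (-q ^ 2), fun x hx => fhQ_ne_zero_of (-q ^ 2) (landen_h₃ q hq1) x hx⟩

/-- **The Landen substitution**: `[T_A(s)] ≡ [T_B(s)]` by ONE rule-(2) move along `(x,y) ↦ (x²,y²)`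
(`T_B(x²,y²)·4xy = 2s·xy/((xy)² − q²) = T_A(x,y)` on the square). (cite KontsevichZagier2001, §1.2 rule (2)) -/
theorem landenA_rel_landenB (s : ℚ) :
    KZ.of (landenA q hq1 s).rep - KZ.of (landenB q hq1 s).rep ∈ KZ.relations := by
  refine rel_coordPow two_ne_zero _ _ fun x hx => ?_
  have n₁ := fhQ_ne_zero_of q (landen_h₁ q hq1) x hx
  have n₂ := fhQ_ne_zero_of (-q) (landen_h₂ q hq1) x hx
  have n₃ := fhQ_ne_zero_of (-q ^ 2) (landen_h₃ q hq1) _ (coordPow_mem_cube 2 hx)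
  simp only [RFun.fn_apply, landenA, landenB, map_mul, aeval_fhQ, MvPolynomial.aeval_C, MvPolynomial.aeval_X,
    eq_ratCast, Fin.prod_univ_two, BoxIntegral.coordPow_apply] at n₁ n₂ n₃ ⊢
  push_cast at n₁ n₂ n₃ ⊢
  field_simp
  ring

/-- `s·P_L/Q_L = T_A(s) − T_B(s)` on the square (rule (1)). [folklore] -/
theorem smul_landenR_rel_sub (s : ℚ) :
    KZ.of (smulNum s (landenR q hq1)).rep - KZ.of ((landenA q hq1 s).sub (landenB q hq1 s)).rep
      ∈ KZ.relations := by
  refine RFun.rel_of_eqOn fun x hx => ?_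
  rw [RFun.fn_sub hx, fn_smulNum]
  have n₁ := fhQ_ne_zero_of q (landen_h₁ q hq1) x hx
  have n₂ := fhQ_ne_zero_of (-q) (landen_h₂ q hq1) x hx
  have n₃ := fhQ_ne_zero_of (-q ^ 2) (landen_h₃ q hq1) x hx
  simp only [RFun.fn_apply, landenR, landenP, landenQ, landenA, landenB, map_mul, map_add, map_sub, aeval_fhQ,
    MvPolynomial.aeval_C, MvPolynomial.aeval_X, eq_ratCast, Fin.prod_univ_two] at n₁ n₂ n₃ ⊢
  push_cast at n₁ n₂ n₃ ⊢
  field_simp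
  ring

/-- **THE LANDEN RELATION INSIDE THE CALCULUS: `[s·P_L/Q_L] ∈ relations` for every `s ∈ ℚ`.** Rule (1)
splits `s·P_L/Q_L = T_A(s) − T_B(s)`; ONE rule-(2) move `(x,y) ↦ (x²,y²)` identifies `[T_A(s)] ≡ [T_B(s)]`.
This is the formal counterpart of Landen's duplication `Li₂(z) + Li₂(−z) = ½Li₂(z²)` — the move THEOREM U
never uses. (cite KontsevichZagier2001, §1.2) -/
theorem smul_landenR_mem_relations (s : ℚ) : KZ.of (smulNum s (landenR q hq1)).rep ∈ KZ.relations := by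
  have h1 := smul_landenR_rel_sub q hq1 s
  have h2 := RFun.rel_sub (landenA q hq1 s) (landenB q hq1 s)
  have h3 := landenA_rel_landenB q hq1 s
  have e : KZ.of (smulNum s (landenR q hq1)).rep
      = (KZ.of (smulNum s (landenR q hq1)).rep - KZ.of ((landenA q hq1 s).sub (landenB q hq1 s)).rep)
        + (KZ.of ((landenA q hq1 s).sub (landenB q hq1 s)).rep
            - (KZ.of (landenA q hq1 s).rep - KZ.of (landenB q hq1 s).rep))
        + (KZ.of (landenA q hq1 s).rep - KZ.of (landenB q hq1 s).rep) := by abel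
  rw [e]
  exact add_mem (add_mem h1 h2) h3

end LandenDecided
end SubstitutionMove
end LetterCriterion
end Summit.KontsevichZagierPeriods.RootDecompRationalCubeDichotomy.Rung26322.RankDescent
end
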